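import Summits.ABC.IUTFork.Cor312RamifiedEOrbitHull
import Summits.ABC.IUTFork.Repair.CandMochizuki7RamE
import Mathlib.LinearAlgebra.Matrix.ToLin
import Mathlib.LinearAlgebra.Matrix.Determinant.Basic
import HarnessLib

/-!
# [IUTchIII] Cor. 3.12 — the ramified bed of index `e`: NO element of the (Ind1),(Ind2)-group of `GL(I)` maps a polydisc ONTO a different polydisc
# (`Φ(box k) = box k' ⇒ k = k'`) — the INDEX of the polydiscs in the packet lattice is an invariant of every reading of Ism

Proof-only record file (D-0012; one bookkeeping `def` `boxIdx`, no `Prop` fact; nothing asserted about print) of the abc-iut cell, IUT REPAIR BRANCH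
(rung LADDER-ABC:A2.RP), seat abc-iut-rp-m1 (gen 5; class (ii)). TAKES NO SIDE on [IUTchIII] Cor. 3.12 or on any author. Over gen 4's
`Cor312RamifiedEShells` / `…EPolydiscs` / `…EOrbitHull` (`K = ℚ_p(π)`, `π^e = p`; packet lattice `𝕀 = ⊗I`; polydiscs `box k` ↔ `π^k𝒪_L`;
`actsIntegrally_of_mem_closure`: every `Φ ∈ ⟨Ind1∪Ind2⟩` of the Dupuy–Hilado reading `GL(I)` maps `𝕀` onto `𝕀`).

THE INVARIANT. In the tensor basis, `box k = D_k·𝕀` for the diagonal `D_k = diag(p^{n_ε(k)})`, `n_ε(k) = ⌈(k − wt ε)/e⌉` (`boxIdx`); an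
`𝕀`-preserving `Φ` has matrix `A ∈ GL_N(ℤ_(p))`, so `v_p(det A) = 0` (`padicValRat_det_eq_zero`); if `Φ(box k) = box k'` then `D_{k'}⁻¹·A·D_k ∈ GL_N(ℤ_(p))`
as well, whence `Σ_ε n_ε(k) = Σ_ε n_ε(k')` (`sum_boxIdx_eq_of_image_box_eq`) — but `Σ_ε n_ε(k)` is STRICTLY increasing in `k` (`sum_boxIdx_lt`: every
`n_ε` is monotone, and the monomial of weight `k mod e`… strictly gains). KERNEL FACT:
* **`image_box_eq_box_imp_eq` — for every `Φ ∈ ⟨(Ind1)∪(Ind2)⟩` of RAM_e (hence of EVERY reading of the strip-automorphisms / Ism inside `GL(I)`),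
  every label `j`, every `k, k'`: `Φ_j(box k) = box k' ⇒ k = k'`.** The p-adic INDEX `[box k′ : box k]` cannot be changed by a lattice automorphism,
  however large the reading of Ism — the box-level companion of gen 5's `image_piEltE_eq_piEltE_imp` (isometric readings, elements) that holds for
  the full Dupuy–Hilado group.
USE (sequel `Repair/CandMochizuki7RamEPinsExcludeObject`): under the Corollary's two region pins the OBJECT sentence `PilotKummerIndRelated` reads, at label
2, `box m = Φ(box 4m)` for some indeterminacy `Φ` — impossible for `m ≥ 1`, for EVERY reading: on the honest ramified bed the pins EXCLUDE the OBJECT at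
every index and depth. Interface-level toy over `toyIndex`; nothing here bears on which reading of Thm. 3.11 is right. [claim: Mochizuki2012, status: disputed]
[cite: DupuyHilado2025, §4.9]
-/

noncomputable section

namespace Summit.ABC.IUTFork.Cor312Vol.RamifiedEWitness

open Set Thm311 Cor312 Cor312.Checks Cor312.IdentifiedNonVacuity NaiveWitness Literature.IUT.LogThetaLattice
open RamifiedWitness (PLe IsPInt ple_zero isPInt_one isPInt_intCast ple_ppow_iff ple_ppow_mul_iff isPInt_prod ple_sum)

variable (p e : ℕ)

/-! ## 1. Determinants of `p`-integral matrices -/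

section Det

variable {p} [hp : Fact p.Prime] {ι : Type} [Fintype ι] [DecidableEq ι]

/-- The determinant of a `p`-integral matrix is `p`-integral. [folklore] -/
theorem isPInt_det {A : Matrix ι ι ℚ} (hA : ∀ i j, IsPInt p (A i j)) : IsPInt p A.det := by
  rw [Matrix.det_apply']
  refine ple_sum _ _ fun σ _ => IsPInt.mul' (isPInt_intCast _) (isPInt_prod _ _ fun i _ => hA _ _)

/-- **A `p`-integral matrix with a `p`-integral inverse has a `p`-UNIT determinant** (`v_p(det A) = 0`, `det A ≠ 0`). [folklore] -/
theorem padicValRat_det_eq_zero {A B : Matrix ι ι ℚ} (hA : ∀ i j, IsPInt p (A i j)) (hB : ∀ i j, IsPInt p (B i j)) (h : A * B = 1) :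
    A.det ≠ 0 ∧ padicValRat p A.det = 0 := by
  have hdet : A.det * B.det = 1 := by rw [← Matrix.det_mul, h, Matrix.det_one]
  have hA0 : A.det ≠ 0 := fun h0 => by rw [h0, zero_mul] at hdet; exact zero_ne_one hdet
  have hB0 : B.det ≠ 0 := fun h0 => by rw [h0, mul_zero] at hdet; exact zero_ne_one hdet
  have hv : padicValRat p A.det + padicValRat p B.det = 0 := by
    rw [← padicValRat.mul hA0 hB0, hdet, padicValRat.one]
  have h1 : 0 ≤ padicValRat p A.det := (isPInt_det hA).resolve_left hA0
  have h2 : 0 ≤ padicValRat p B.det := (isPInt_det hB).resolve_left hB0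
  exact ⟨hA0, by omega⟩

omit [Fintype ι] in
/-- The valuation of a product of `p`-powers is the sum of the exponents. [folklore] -/
theorem padicValRat_prod_ppow (s : Finset ι) (n : ι → ℤ) :
    (∏ i ∈ s, (p : ℚ) ^ n i) ≠ 0 ∧ padicValRat p (∏ i ∈ s, (p : ℚ) ^ n i) = ∑ i ∈ s, n i := by
  induction s using Finset.induction_on with
  | empty => simp
  | insert a s ha ih =>
    rw [Finset.prod_insert ha, Finset.sum_insert ha]
    refine ⟨mul_ne_zero (ppow_ne_zero p _) ih.1, ?_⟩
    rw [padicValRat.mul (ppow_ne_zero p _) ih.1, padicValRat_ppow, ih.2]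

end Det

/-! ## 2. The box indices `n_ε(k) = ⌈(k − wt ε)/e⌉` and membership in `box k` -/

/-- The exponent of `p` in the `ε`-th diagonal entry of `box k = D_k·𝕀`: `n_ε(k) = ⌈(k − wt ε)/e⌉`. Bookkeeping. [folklore] -/
def boxIdx {j : toyIndex.Label} (k : ℤ) (ε : toyIndex.Caps j → Fin e) : ℤ := hullIdx e k (wt e ε)

variable {p e} [hp : Fact p.Prime] [NeZero e]

omit hp in
/-- **Membership in a polydisc through the indices: `x ∈ box k ⟺ v_p(x_ε) ≥ n_ε(k)` for every nonzero coordinate.** [folklore] -/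
theorem mem_box_iff_ple {j : toyIndex.Label} {vQ : toyIndex.VQ} (k : ℤ) (x : (ramShellsE p e).Packet j vQ) :
    x ∈ box p e j vQ k ↔ ∀ ε, PLe p (boxIdx e k ε) (coord p e j vQ x ε) := by
  refine forall_congr' fun ε => or_congr Iff.rfl ?_
  have hb := hullIdx_bounds (e := e) (NeZero.one_le) k (wt e ε)
  have he := Repair.CandMochizuki7RamE.e_pos e
  unfold boxIdx
  constructor
  · intro h
    by_contra hlt
    push Not at hlt
    have h1 : (e : ℤ) * (padicValRat p (coord p e j vQ x ε) + 1) ≤ (e : ℤ) * hullIdx e k (wt e ε) :=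
      mul_le_mul_of_nonneg_left (by omega) he.le
    rw [mul_add, mul_one] at h1
    omega
  · intro h
    have h1 : (e : ℤ) * hullIdx e k (wt e ε) ≤ (e : ℤ) * padicValRat p (coord p e j vQ x ε) := mul_le_mul_of_nonneg_left h he.le
    omega

/-- The monomial `p^{n_ε(k)}·e_ε` lies in `box k`. [folklore] -/
theorem ppow_boxIdx_smul_tb_mem_box {j : toyIndex.Label} (vQ : toyIndex.VQ) (k : ℤ) (ε : toyIndex.Caps j → Fin e) :
    (p : ℚ) ^ boxIdx e k ε • tb p e j vQ ε ∈ box p e j vQ k := by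
  rw [ppow_smul_tb_mem_box_iff]
  have hb := hullIdx_bounds (e := e) (NeZero.one_le) k (wt e ε)
  unfold boxIdx
  omega

/-- `n_ε` is monotone in `k`. [folklore] -/
theorem boxIdx_mono {j : toyIndex.Label} {k k' : ℤ} (h : k ≤ k') (ε : toyIndex.Caps j → Fin e) : boxIdx e k ε ≤ boxIdx e k' ε := by
  unfold boxIdx hullIdx
  exact Int.ediv_le_ediv (Repair.CandMochizuki7RamE.e_pos e) (by omega)

/-- At the monomial of weight `k mod e` the index JUMPS between `k` and any `k' > k`: `n(k) = ⌊k/e⌋ < n(k')`. [folklore] -/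
theorem boxIdx_lt_at_res {j : toyIndex.Label} {k k' : ℤ} (h : k < k') (ε : toyIndex.Caps j → Fin e) (hε : (wt e ε : ℤ) = k % e) :
    boxIdx e k ε < boxIdx e k' ε := by
  have he := Repair.CandMochizuki7RamE.e_pos e
  have hb := hullIdx_bounds (e := e) (NeZero.one_le) k (wt e ε)
  have hb' := hullIdx_bounds (e := e) (NeZero.one_le) k' (wt e ε)
  have hdiv := Int.mul_ediv_add_emod k e   -- e * (k / e) + k % e = k
  unfold boxIdx
  -- `e·n(k) ≤ k − wt + e − 1 = e·(k/e) + e − 1 < e·(k/e + 1)` and `e·n(k') ≥ k' − wt > k − wt = e·(k/e)`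
  have h1 : (e : ℤ) * hullIdx e k (wt e ε) < (e : ℤ) * (k / e + 1) := by rw [mul_add, mul_one]; omega
  have h2 : (e : ℤ) * (k / e) < (e : ℤ) * hullIdx e k' (wt e ε) := by omega
  have h3 := lt_of_mul_lt_mul_left h1 he.le
  have h4 := lt_of_mul_lt_mul_left h2 he.le
  omega

/-- A tensor index of weight `k mod e` exists at every label (`π^{k mod e}` on the first factor). [folklore] -/
theorem exists_wt_eq_emod {j : toyIndex.Label} (k : ℤ) : ∃ ε : toyIndex.Caps j → Fin e, (wt e ε : ℤ) = k % e := by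
  have he := Repair.CandMochizuki7RamE.e_pos e
  have h0 := Int.emod_nonneg k he.ne'
  have h1 := Int.emod_lt_of_pos k he
  refine ⟨idx1 e j ⟨(k % e).toNat, ?_⟩, ?_⟩
  · have : ((k % e).toNat : ℤ) < e := by rw [Int.toNat_of_nonneg h0]; exact h1
    exact_mod_cast this
  · rw [wt_idx1]
    exact Int.toNat_of_nonneg h0

/-- **`Σ_ε n_ε(k)` is STRICTLY increasing in `k`.** [folklore] -/
theorem sum_boxIdx_lt {j : toyIndex.Label} {k k' : ℤ} (h : k < k') :
    ∑ ε : toyIndex.Caps j → Fin e, boxIdx e k ε < ∑ ε : toyIndex.Caps j → Fin e, boxIdx e k' ε := by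
  obtain ⟨ε₀, hε₀⟩ := exists_wt_eq_emod (e := e) (j := j) k
  exact Finset.sum_lt_sum (fun ε _ => boxIdx_mono h.le ε) ⟨ε₀, Finset.mem_univ _, boxIdx_lt_at_res h ε₀ hε₀⟩

/-! ## 3. The matrix of an indeterminacy; conjugation by the diagonal `D_k = diag(p^{n_ε(k)})` -/

section MatrixPart

variable {j : toyIndex.Label} {vQ : toyIndex.VQ}

omit hp [NeZero e] in
/-- The matrix of a linear self-map of a packet in the tensor basis has entries `(f e_{ε'})_ε`. [folklore] -/
theorem toMatrix_tb_apply (f : (ramShellsE p e).Packet j vQ →ₗ[ℚ] (ramShellsE p e).Packet j vQ) (ε ε' : toyIndex.Caps j → Fin e) :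
    LinearMap.toMatrix (tb p e j vQ) (tb p e j vQ) f ε ε' = coord p e j vQ (f (tb p e j vQ ε')) ε := by
  rw [LinearMap.toMatrix_apply]; rfl

omit hp [NeZero e] in
/-- The matrix of a packet automorphism times the matrix of its inverse is `1`. [folklore] -/
theorem toMatrix_mul_toMatrix_symm (f : (ramShellsE p e).Packet j vQ ≃ₗ[ℚ] (ramShellsE p e).Packet j vQ) :
    LinearMap.toMatrix (tb p e j vQ) (tb p e j vQ) f.toLinearMap * LinearMap.toMatrix (tb p e j vQ) (tb p e j vQ) f.symm.toLinearMap = 1 := by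
  rw [← LinearMap.toMatrix_mul, ← LinearMap.toMatrix_one (tb p e j vQ)]
  congr 1
  exact LinearMap.ext fun x => f.apply_symm_apply x

/-- **The CONJUGATED MATRIX** `D_{k'}⁻¹ · A · D_k` of a linear self-map `f` (matrix `A` in the tensor basis), `D_k = diag(p^{n_ε(k)})`. [folklore] -/
def conjMat (k k' : ℤ) (f : (ramShellsE p e).Packet j vQ →ₗ[ℚ] (ramShellsE p e).Packet j vQ) :
    Matrix (toyIndex.Caps j → Fin e) (toyIndex.Caps j → Fin e) ℚ :=
  Matrix.diagonal (fun ε => (p : ℚ) ^ (-boxIdx e k' ε)) * LinearMap.toMatrix (tb p e j vQ) (tb p e j vQ) f *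
    Matrix.diagonal (fun ε => (p : ℚ) ^ boxIdx e k ε)

omit hp [NeZero e] in
/-- Its entries: `(D_{k'}⁻¹ A D_k)_{ε ε'} = p^{−n_ε(k')} · (f (p^{n_{ε'}(k)}·e_{ε'}))_ε`. [folklore] -/
theorem conjMat_apply (k k' : ℤ) (f : (ramShellsE p e).Packet j vQ →ₗ[ℚ] (ramShellsE p e).Packet j vQ) (ε ε' : toyIndex.Caps j → Fin e) :
    conjMat k k' f ε ε' = (p : ℚ) ^ (-boxIdx e k' ε) * coord p e j vQ (f ((p : ℚ) ^ boxIdx e k ε' • tb p e j vQ ε')) ε := by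
  unfold conjMat
  rw [Matrix.mul_diagonal, Matrix.diagonal_mul, toMatrix_tb_apply, map_smul, coord_smul]
  ring

/-- **If `f` maps `box k` into `box k'`, the conjugated matrix is `p`-integral.** [folklore] -/
theorem isPInt_conjMat {k k' : ℤ} {f : (ramShellsE p e).Packet j vQ →ₗ[ℚ] (ramShellsE p e).Packet j vQ}
    (hf : ∀ x ∈ box p e j vQ k, f x ∈ box p e j vQ k') (ε ε' : toyIndex.Caps j → Fin e) : IsPInt p (conjMat k k' f ε ε') := by
  rw [conjMat_apply]
  have hx := (mem_box_iff_ple k' _).1 (hf _ (ppow_boxIdx_smul_tb_mem_box vQ k ε')) ε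
  have h := (ple_ppow_mul_iff (p := p) (-boxIdx e k' ε) 0 (coord p e j vQ (f ((p : ℚ) ^ boxIdx e k ε' • tb p e j vQ ε')) ε)).2
    (by rw [sub_neg_eq_add, zero_add]; exact hx)
  exact h

omit [NeZero e] in
/-- The two conjugated matrices of `f` and `f⁻¹` (with the roles of `k`, `k'` exchanged) are mutually inverse. [folklore] -/
theorem conjMat_mul_conjMat_symm (k k' : ℤ) (f : (ramShellsE p e).Packet j vQ ≃ₗ[ℚ] (ramShellsE p e).Packet j vQ) :
    conjMat k k' f.toLinearMap * conjMat k' k f.symm.toLinearMap = 1 := by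
  unfold conjMat
  have hp0 : (p : ℚ) ≠ 0 := Nat.cast_ne_zero.mpr hp.out.ne_zero
  have hD1 : Matrix.diagonal (fun ε : toyIndex.Caps j → Fin e => (p : ℚ) ^ boxIdx e k ε) *
      Matrix.diagonal (fun ε => (p : ℚ) ^ (-boxIdx e k ε)) = 1 := by
    rw [Matrix.diagonal_mul_diagonal, ← Matrix.diagonal_one]
    congr 1
    funext ε
    rw [← zpow_add₀ hp0, add_neg_cancel, zpow_zero]
  have hD2 : Matrix.diagonal (fun ε : toyIndex.Caps j → Fin e => (p : ℚ) ^ (-boxIdx e k' ε)) *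
      Matrix.diagonal (fun ε => (p : ℚ) ^ boxIdx e k' ε) = 1 := by
    rw [Matrix.diagonal_mul_diagonal, ← Matrix.diagonal_one]
    congr 1
    funext ε
    rw [← zpow_add₀ hp0, neg_add_cancel, zpow_zero]
  simp only [Matrix.mul_assoc]
  rw [← Matrix.mul_assoc (Matrix.diagonal fun ε : toyIndex.Caps j → Fin e => (p : ℚ) ^ boxIdx e k ε), hD1, Matrix.one_mul,
    ← Matrix.mul_assoc (LinearMap.toMatrix (tb p e j vQ) (tb p e j vQ) f.toLinearMap), toMatrix_mul_toMatrix_symm, Matrix.one_mul, hD2]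

omit [NeZero e] in
/-- The determinant of the conjugated matrix: `det A · p^{Σ n(k) − Σ n(k')}` — its valuation. [folklore] -/
theorem padicValRat_det_conjMat (k k' : ℤ) (f : (ramShellsE p e).Packet j vQ →ₗ[ℚ] (ramShellsE p e).Packet j vQ)
    (hA : (LinearMap.toMatrix (tb p e j vQ) (tb p e j vQ) f).det ≠ 0) :
    padicValRat p (conjMat k k' f).det =
      padicValRat p (LinearMap.toMatrix (tb p e j vQ) (tb p e j vQ) f).det + ∑ ε : toyIndex.Caps j → Fin e, boxIdx e k ε -
        ∑ ε : toyIndex.Caps j → Fin e, boxIdx e k' ε := by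
  unfold conjMat
  have h1 := padicValRat_prod_ppow (p := p) (Finset.univ : Finset (toyIndex.Caps j → Fin e)) (fun ε => -boxIdx e k' ε)
  have h2 := padicValRat_prod_ppow (p := p) (Finset.univ : Finset (toyIndex.Caps j → Fin e)) (fun ε => boxIdx e k ε)
  rw [Matrix.det_mul, Matrix.det_mul, Matrix.det_diagonal, Matrix.det_diagonal, padicValRat.mul (mul_ne_zero h1.1 hA) h2.1,
    padicValRat.mul h1.1 hA, h1.2, h2.2, Finset.sum_neg_distrib]
  ring

end MatrixPart

/-! ## 4. The invariant -/

/-- **`Σ_ε n_ε(k) = Σ_ε n_ε(k')` whenever an element of ⟨(Ind1)∪(Ind2)⟩ maps `box k` ONTO `box k'`** (both `A` and `D_{k'}⁻¹ A D_k` are `p`-unimodular).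
[folklore] -/
theorem sum_boxIdx_eq_of_image_box_eq {Φ : (ramShellsE p e).PacketAut} (hΦ : Φ ∈ indG p e) (j : toyIndex.Label) (vQ : toyIndex.VQ) {k k' : ℤ}
    (h : Φ j vQ '' box p e j vQ k = box p e j vQ k') :
    ∑ ε : toyIndex.Caps j → Fin e, boxIdx e k ε = ∑ ε : toyIndex.Caps j → Fin e, boxIdx e k' ε := by
  have hint := actsIntegrally_of_mem_closure hΦ
  -- the matrix of `Φ_j` and of its inverse are `p`-integral
  have hA : ∀ ε ε', IsPInt p (LinearMap.toMatrix (tb p e j vQ) (tb p e j vQ) (Φ j vQ).toLinearMap ε ε') := fun ε ε' => by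
    rw [toMatrix_tb_apply]; exact hint.fwd j vQ _ (integral_tb j vQ ε') ε
  have hA' : ∀ ε ε', IsPInt p (LinearMap.toMatrix (tb p e j vQ) (tb p e j vQ) (Φ j vQ).symm.toLinearMap ε ε') := fun ε ε' => by
    rw [toMatrix_tb_apply]
    have h' := hint.bwd j vQ _ (integral_tb j vQ ε') ε
    rwa [Pi.inv_apply, Pi.inv_apply] at h'
  have hdetA := padicValRat_det_eq_zero hA hA' (toMatrix_mul_toMatrix_symm (Φ j vQ))
  -- `Φ` maps `box k` into `box k'` and `Φ⁻¹` maps `box k'` into `box k`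
  have hfwd : ∀ x ∈ box p e j vQ k, (Φ j vQ).toLinearMap x ∈ box p e j vQ k' := fun x hx => by
    rw [← h]; exact Set.mem_image_of_mem _ hx
  have hbwd : ∀ y ∈ box p e j vQ k', (Φ j vQ).symm.toLinearMap y ∈ box p e j vQ k := fun y hy => by
    rw [← h] at hy
    obtain ⟨x, hx, hxy⟩ := hy
    rw [← hxy]
    show (Φ j vQ).symm (Φ j vQ x) ∈ _
    rwa [LinearEquiv.symm_apply_apply]
  have hG := padicValRat_det_eq_zero (fun ε ε' => isPInt_conjMat hfwd ε ε') (fun ε ε' => isPInt_conjMat hbwd ε ε')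
    (conjMat_mul_conjMat_symm k k' (Φ j vQ))
  have hv := padicValRat_det_conjMat k k' (Φ j vQ).toLinearMap hdetA.1
  rw [hG.2, hdetA.2] at hv
  omega

/-- **NO element of ⟨(Ind1)∪(Ind2)⟩ of RAM_e — hence of ANY reading of the strip-automorphisms / Ism inside `GL(I)` — maps a polydisc ONTO a DIFFERENT
polydisc: `Φ_j(box k) = box k' ⇒ k = k'`.** [claim: Mochizuki2012, status: disputed] -/
theorem image_box_eq_box_imp_eq {Φ : (ramShellsE p e).PacketAut} (hΦ : Φ ∈ indG p e) (j : toyIndex.Label) (vQ : toyIndex.VQ) {k k' : ℤ}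
    (h : Φ j vQ '' box p e j vQ k = box p e j vQ k') : k = k' := by
  have hs := sum_boxIdx_eq_of_image_box_eq hΦ j vQ h
  rcases lt_trichotomy k k' with hlt | heq | hgt
  · exact absurd hs (sum_boxIdx_lt hlt).ne
  · exact heq
  · exact absurd hs (sum_boxIdx_lt hgt).ne'

end Summit.ABC.IUTFork.Cor312Vol.RamifiedEWitness

end
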